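/-
Copyright (c) 2026. All rights reserved.
Released under Apache 2.0 license as described in the file LICENSE.
Authors: HodgeCM publication cell (pub-hodgecm), GR lane, seat GR-2 (`pub-hodgecm-own-hyp34`).
-/
import Literature.NumberTheory.Weil1964.ArchActQuadraticPlaces
import Literature.NumberTheory.Weil1964.ArchFollandFrameGen
import Literature.NumberTheory.Automorphic.UnitaryGroupArchComplexPair
import HarnessLib

/-!
# Restriction of scalars `E/F` read at a COMPLEX place of `F`: the archimedean `v`-slices of `ι_𝔸` (split pair)

Topic `NumberTheory/Weil1964`; namespace `Literature.NumberTheory.Weil1964`.  KERNEL ONLY: definitions with bodies and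
theorems; no `def … : Prop` record, no `axiom`, no proof hole.

The complex-place twin of `ArchActQuadraticPlaces` (which reads `Res_{𝔸_E/𝔸_F}` at a REAL place `v` of `F` under a
complex place `w` of `E`, `E ⊗_F F_v = ℂ`).  Here `v` is a COMPLEX place of `F`; the places of the quadratic extension
`E/F` over `v` are a pair `(w, c w)` (`c` the involution), `E ⊗_F F_v = E_w × E_{cw} = ℂ × ℂ`, and in the
coordinates `1, δ ⊗ 1 = (s, -s)` (`s = σ_w(δ)`) restriction of scalars is the split quadratic algebra of
`UnitaryGroupArchComplexPair` (`splitPairCoords`, `isQuadraticCoordinates_splitPair`):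

* §1 **`placeTwist v w : ℂ →+* ℂ`** — the continuous ring endomorphism (`= id` or `conj`, `placeTwist_eq_id_or_conj`)
  through which the local base change `ι_w : F_v → E_w` reads in Mathlib's complex coordinates:
  `σ_w (ι_w y) = placeTwist (σ_v y)` (`placeTwist_extensionEmbedding`), `placeTwist (σ_v t) = σ_w t` on `F`; it is an
  involution preserving real parts; and the pair-reading twist of `UnitaryGroupArchComplexPair` cancels it on the
  partner: `ψ_{cw} ∘ placeTwist v (cw) = placeTwist v w` (`conjCoord_placeTwist_cPlaceC`).
* §2 `adeleAtCC w : 𝔸_E →+* ℂ × ℂ`, `Y ↦ (σ_w Y_w, ψ_{cw}(σ_{cw} Y_{cw}))` — on archimedean matrices `(g, 1)` it is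
  the `(w, cw)`-evaluation `evalCC` of `UnitaryGroupArchComplexPair` (`map_adeleAtCC_coe_archToAdelic`); and the
  **CORE** `placeVecC_piArch_resEnd`: for `G ∈ Mₙ(𝔸_E)` the `v`-slices of `Res G` on an archimedean pair `(a, b)`,
  READ THROUGH `placeTwist v w`, are the split-pair restriction of scalars of `G.map (adeleAtCC w)` on the twisted
  slices `(ψ a_v, ψ b_v)` — any fintype index, no unitarity.
* §3 through the unitary carrier maps: **`placeVecC_archAct_adelicToSymplectic`** (`ι_𝔸 = adelicToSymplectic`) and, for
  an archimedean element `u = (g, 1)`, **`placeVecC_archAct_archToAdelic`**: the twisted `v`-slices of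
  `archAct (ι_𝔸 (g, 1))` are `toSymplectic` (the tree's `U(σ, T ⊗ 1) → Sp(polar β_T)` over `R = ℂ`, `S = ℂ × ℂ`) of the
  `(w, cw)`-factor `archAtComplexSplit w g` — the complex-place twin of `placeVec_archAct_adelicToSymplectic`.

Dictionary with print: `E ⊗_F F_v = ∏_{w ∣ v} E_w` [CasselsFrohlichANT1967, Ch. II §14]; at a complex place of `F`
the unitary group `U(J)(F_v)` is `GL_n(ℂ)` and sits in `Sp(Res_{E/F} V)(F_v) = Sp_{2n}(ℂ)` as (a conjugate of)
the Siegel Levi [MoeglinVignerasWaldspurger1987, Chap. 1 I.17–I.19]; the present file is the adelic bookkeeping of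
that statement against the tree's `Ψ_𝔸`, `Ψ_v`, `toInfPlace` and Mathlib's `extensionEmbedding`; no analysis.

## References
* [GelbartRogawski1991] S. Gelbart, J. Rogawski, Invent. Math. 105 (1991), §3.1 p. 454.
* [CasselsFrohlichANT1967] J. W. S. Cassels, A. Fröhlich (eds.), *Algebraic Number Theory* (1967), Ch. II §14.
* [MoeglinVignerasWaldspurger1987] C. Mœglin, M.-F. Vignéras, J.-L. Waldspurger, LNM 1291 (1987), Chap. 1 I.17–I.19.
* [PlatonovRapinchuk1994] V. Platonov, A. Rapinchuk, *Algebraic Groups and Number Theory* (1994), §2.3, §3.2.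
-/

set_option autoImplicit false

noncomputable section

open scoped Matrix ComplexConjugate
open NumberField NumberField.InfinitePlace NumberField.mixedEmbedding IsDedekindDomain

namespace Literature.NumberTheory.Weil1964

open Literature.NumberTheory.Automorphic Literature.NumberTheory.Automorphic.UnitaryGroup QuadraticCoordinates

/-! ## §1 The coordinate twist `placeTwist v w : ℂ →+* ℂ` of the local base change at a complex place -/

section Twist

variable (F : Type) [Field F] (E : Type) [Field E] [Algebra F E]
  (v : {v : InfinitePlace F // v.IsComplex}) (w : InfPlacesOver E v.1)

/-- **`placeTwist v w = σ_w ∘ ι_w ∘ σ_v⁻¹ : ℂ →+* ℂ`** — the local base change `ι_w : F_v → E_w` at a place `w` of `E`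
over the COMPLEX place `v` of `F`, read in Mathlib's complex coordinates `σ_v : F_v ≅ ℂ`, `σ_w : E_w → ℂ`.
[cite: CasselsFrohlichANT1967, Ch. II §14] -/
def placeTwist : ℂ →+* ℂ :=
  (Completion.extensionEmbedding w.1).comp
    ((toInfPlace E v.1 w).comp (Completion.ringEquivComplexOfIsComplex v.2).symm.toRingHom)

/-- `placeTwist` is continuous. [cite: CasselsFrohlichANT1967, Ch. II §14] -/
theorem continuous_placeTwist : Continuous (placeTwist F E v w) :=
  (Completion.isometry_extensionEmbedding w.1).continuous.comp
    ((continuous_toInfPlace E v.1 w).comp (Completion.isometryEquivComplexOfIsComplex v.2).symm.continuous)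

/-- **`σ_w (ι_w y) = placeTwist (σ_v y)`** for `y ∈ F_v`. [cite: CasselsFrohlichANT1967, Ch. II §14] -/
theorem placeTwist_extensionEmbedding (y : v.1.Completion) :
    placeTwist F E v w (Completion.extensionEmbedding v.1 y) = Completion.extensionEmbedding w.1 (toInfPlace E v.1 w y) := by
  simp only [placeTwist, RingHom.coe_comp, RingEquiv.toRingHom_eq_coe, RingHom.coe_coe, Function.comp_apply]
  rw [← Completion.ringEquivComplexOfIsComplex_apply v.2, RingEquiv.symm_apply_apply]

/-- on `F`: `placeTwist (σ_v t) = σ_w (t)`. [cite: CasselsFrohlichANT1967, Ch. II §14] -/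
theorem placeTwist_embedding (t : F) :
    placeTwist F E v w (v.1.embedding t) = w.1.embedding (algebraMap F E t) := by
  have h1 : Completion.extensionEmbedding v.1 ((t : F) : v.1.Completion) = v.1.embedding t :=
    Completion.extensionEmbedding_coe v.1 (WithAbs.toAbs v.1.1 t)
  have h2 : Completion.extensionEmbedding w.1 ((algebraMap F E t : E) : w.1.Completion) = w.1.embedding (algebraMap F E t) :=
    Completion.extensionEmbedding_coe w.1 (WithAbs.toAbs w.1.1 (algebraMap F E t))
  rw [← h1, placeTwist_extensionEmbedding, toInfPlace_coe, h2]

/-- `placeTwist` is the identity or complex conjugation. [cite: CasselsFrohlichANT1967, Ch. II §14] -/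
theorem placeTwist_eq_id_or_conj : placeTwist F E v w = RingHom.id ℂ ∨ placeTwist F E v w = starRingEnd ℂ :=
  Complex.ringHom_eq_id_or_conj_of_continuous (continuous_placeTwist F E v w)

/-- `placeTwist` is an involution. [cite: CasselsFrohlichANT1967, Ch. II §14] -/
@[simp] theorem placeTwist_placeTwist (z : ℂ) : placeTwist F E v w (placeTwist F E v w z) = z := by
  rcases placeTwist_eq_id_or_conj F E v w with h | h <;> rw [h]
  · rfl
  · exact Complex.conj_conj z

/-- `placeTwist` preserves real parts. [cite: CasselsFrohlichANT1967, Ch. II §14] -/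
theorem re_placeTwist (z : ℂ) : (placeTwist F E v w z).re = z.re := by
  rcases placeTwist_eq_id_or_conj F E v w with h | h <;> rw [h]
  · rfl
  · exact Complex.conj_re z

/-- `placeTwist` is `ℝ`-linear. [cite: CasselsFrohlichANT1967, Ch. II §14] -/
theorem placeTwist_ofReal_mul (r : ℝ) (z : ℂ) : placeTwist F E v w ((r : ℂ) * z) = (r : ℂ) * placeTwist F E v w z := by
  rcases placeTwist_eq_id_or_conj F E v w with h | h <;> rw [h]
  · rfl
  · rw [map_mul, Complex.conj_ofReal]

/-- a continuous ring endomorphism of `ℂ` agreeing with `placeTwist` on `σ_v(F)` IS `placeTwist` (`v` complex: `σ_v(F)`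
is not pointwise fixed by conjugation). [cite: PlatonovRapinchuk1994, §2.3] -/
theorem eq_placeTwist_of_continuous {f : ℂ →+* ℂ} (hf : Continuous f)
    (hfe : ∀ t : F, f (v.1.embedding t) = placeTwist F E v w (v.1.embedding t)) : f = placeTwist F E v w := by
  have key : ∀ {g g' : ℂ →+* ℂ}, g = RingHom.id ℂ → g' = starRingEnd ℂ →
      (∀ t : F, g (v.1.embedding t) = g' (v.1.embedding t)) → False := by
    intro g g' hg hg' hgg'
    have hreal : ComplexEmbedding.IsReal v.1.embedding := by
      rw [ComplexEmbedding.isReal_iff]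
      ext t
      rw [ComplexEmbedding.conjugate_coe_eq]
      have h1 := hgg' t
      rw [hg, hg'] at h1
      exact h1.symm
    exact (isComplex_iff.mp v.2) hreal
  rcases Complex.ringHom_eq_id_or_conj_of_continuous hf with h | h <;>
    rcases placeTwist_eq_id_or_conj F E v w with h' | h'
  · rw [h, h']
  · exact (key h h' hfe).elim
  · exact (key h' h fun t => (hfe t).symm).elim
  · rw [h, h']

end Twist

/-! ## §2 Reading an adele of `E` at the pair `(w, cw)`; the CORE -/

section Core

variable (F : Type) [Field F] [NumberField F] (E : Type) [Field E] [NumberField E] [Algebra F E]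
  (c : E ≃ₐ[F] E) (hcc : c * c = 1) (n : Type) [Fintype n] [DecidableEq n]
  (v : {v : InfinitePlace F // v.IsComplex}) (w : {w : InfinitePlace E // w.IsComplex})
  (hover : w.1.comap (algebraMap F E) = v.1)

omit [NumberField F] [NumberField E] in
/-- the partner `c w` lies over the same place of `F`. [cite: PlatonovRapinchuk1994, §3.2] -/
theorem comap_cPlaceC : (cPlaceC F E c w).1.comap (algebraMap F E) = w.1.comap (algebraMap F E) := by
  rw [coe_cPlaceC, comap_smul]
  congr 1
  exact RingHom.ext fun t => c.symm.commutes t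

/-- **`adeleAtCC w : 𝔸_E →+* ℂ × ℂ`**, `Y ↦ (σ_w(Y_w), ψ_{cw}(σ_{cw}(Y_{cw})))` — an adele of `E` read at the pair
`(w, cw)`, the partner through the untwisting `ψ_{cw} = conjCoord (cw)`. [cite: CasselsFrohlichANT1967, Ch. II §14] -/
def adeleAtCC : AdeleRing (𝓞 E) E →+* ℂ × ℂ :=
  (adeleAt E w).prod ((conjCoord F E c (cPlaceC F E c w)).comp (adeleAt E (cPlaceC F E c w)))

omit [NumberField F] in
/-- formula. [cite: CasselsFrohlichANT1967, Ch. II §14] -/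
@[simp] theorem adeleAtCC_apply (Y : AdeleRing (𝓞 E) E) :
    adeleAtCC F E c w Y = (adeleAt E w Y, conjCoord F E c (cPlaceC F E c w) (adeleAt E (cPlaceC F E c w) Y)) := rfl

/-- an archimedean matrix `(g, 1)` read at a complex place `w'`: `σ_{w'}(((g,1)ᵢⱼ)_{w'}) = (gᵢⱼ)_{w'}`.
[cite: BorelJacquet1979, §4.1] -/
theorem adeleAt_coe_archToAdelic {N : ℕ} (J : Matrix (Fin N) (Fin N) E) (w' : {w : InfinitePlace E // w.IsComplex})
    (g : arch F E c N J) (i j : Fin N) :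
    adeleAt E w' ((((archToAdelic F E c N J g).1 : GL (Fin N) (AdeleRing (𝓞 E) E)) :
        Matrix (Fin N) (Fin N) (AdeleRing (𝓞 E) E)) i j) =
      ((((g : GL (Fin N) (mixedSpace E)) : Matrix (Fin N) (Fin N) (mixedSpace E)) i j).2 w') := by
  have hu : ((archToAdelic F E c N J g).1 : GL (Fin N) (AdeleRing (𝓞 E) E)) =
      GLn.ofInfinite N E (g : GL (Fin N) (mixedSpace E)) := rfl
  rw [hu, GLn.coe_ofInfinite_apply, adeleAt_apply]
  exact congrArg (fun y : mixedSpace E => y.2 w')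
    ((InfiniteAdeleRing.ringEquiv_mixedSpace E).apply_symm_apply
      ((((g : GL (Fin N) (mixedSpace E)) : Matrix (Fin N) (Fin N) (mixedSpace E)) i j)))

/-- **on archimedean matrices `(g, 1)` the pair-reading is `evalCC`**: `(g, 1).map (adeleAtCC w) = g.map (evalCC w)`.
[cite: BorelJacquet1979, §4.1] -/
theorem map_adeleAtCC_coe_archToAdelic {N : ℕ} (J : Matrix (Fin N) (Fin N) E) (g : arch F E c N J) :
    ((((archToAdelic F E c N J g).1 : GL (Fin N) (AdeleRing (𝓞 E) E)) :
        Matrix (Fin N) (Fin N) (AdeleRing (𝓞 E) E))).map (adeleAtCC F E c w) =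
      (((g : GL (Fin N) (mixedSpace E)) : Matrix (Fin N) (Fin N) (mixedSpace E))).map (evalCC F E c w) := by
  refine Matrix.ext fun i j => ?_
  rw [Matrix.map_apply, Matrix.map_apply, adeleAtCC_apply, evalCC_apply]
  exact Prod.ext (adeleAt_coe_archToAdelic F E c J w g i j)
    (congrArg (conjCoord F E c (cPlaceC F E c w)) (adeleAt_coe_archToAdelic F E c J (cPlaceC F E c w) g i j))

variable [Algebra.IsQuadraticExtension F E]

omit [NumberField F] [NumberField E] [Algebra.IsQuadraticExtension F E] in
include hcc in
/-- **the pair-reading twist cancels the coordinate twist of the partner**: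
`ψ_{cw} (placeTwist v (cw) z) = placeTwist v w z`. [cite: PlatonovRapinchuk1994, §2.3] -/
theorem conjCoord_placeTwist_cPlaceC (z : ℂ) :
    conjCoord F E c (cPlaceC F E c w) (placeTwist F E v ⟨(cPlaceC F E c w).1, (comap_cPlaceC F E c w).trans hover⟩ z) =
      placeTwist F E v ⟨w.1, hover⟩ z := by
  have h := eq_placeTwist_of_continuous F E v ⟨w.1, hover⟩
    (f := (conjCoord F E c (cPlaceC F E c w)).comp
      (placeTwist F E v ⟨(cPlaceC F E c w).1, (comap_cPlaceC F E c w).trans hover⟩))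
    ((continuous_conjCoord F E c _).comp (continuous_placeTwist F E v _)) fun t => by
      rw [RingHom.comp_apply, placeTwist_embedding, placeTwist_embedding]
      show conjCoord F E c (cPlaceC F E c w) ((cPlaceC F E c w).1.embedding (algebraMap F E t)) = _
      rw [conjCoord_embedding, coe_cPlaceC, smul_smul_of_mul_self F E c hcc, AlgEquiv.commutes]
  exact DFunLike.congr_fun h z

variable {δ : E} (hcδ : c δ = -δ) (hδ : δ ≠ 0) {d : F} (hd : δ * δ = algebraMap F E d)

omit [NumberField F] [NumberField E] [Algebra.IsQuadraticExtension F E] in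
include hcc hcδ in
/-- `ψ_{cw} (σ_{cw} δ) = -σ_w δ`. [cite: PlatonovRapinchuk1994, §2.3] -/
theorem conjCoord_embedding_cPlaceC_delta :
    conjCoord F E c (cPlaceC F E c w) ((cPlaceC F E c w).1.embedding δ) = -w.1.embedding δ := by
  rw [conjCoord_embedding, coe_cPlaceC, smul_smul_of_mul_self F E c hcc, hcδ, map_neg]

omit [Fintype n] [DecidableEq n] in
include hcc hover in
/-- **`adeleAtCC w` of `Ψ_𝔸 (archVec a, archVec b)_i` is `splitPairCoords s (ψ a_{i,v}, ψ b_{i,v})`**, `ψ = placeTwist v w`,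
`s = σ_w δ`. [cite: CasselsFrohlichANT1967, Ch. II §14] -/
theorem adeleAtCC_quadraticAdeleEquiv_archVec (a b : n → mixedSpace F) (i : n) :
    adeleAtCC F E c w (quadraticAdeleEquiv F E c hcδ hδ (archVec F n a i, archVec F n b i)) =
      splitPairCoords (w.1.embedding δ) (embedding_ne_zero E w hδ)
        (placeTwist F E v ⟨w.1, hover⟩ (placeVecC F n v a i), placeTwist F E v ⟨w.1, hover⟩ (placeVecC F n v b i)) := by
  -- the base change of an archimedean vector read at a place `w'` over `v`
  have hbc : ∀ (w' : {w : InfinitePlace E // w.IsComplex}) (hw' : w'.1.comap (algebraMap F E) = v.1)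
      (x : n → mixedSpace F),
      Completion.extensionEmbedding w'.1 ((AdeleRing.baseChange F E (archVec F n x i)).1 w'.1) =
        placeTwist F E v ⟨w'.1, hw'⟩ (placeVecC F n v x i) := by
    intro w' hw' x
    rw [AdeleRing.baseChange_fst, infiniteAdele_baseChange_apply_placesOver E v.1 (archVec F n x i).1 ⟨w'.1, hw'⟩,
      ← placeTwist_extensionEmbedding F E v ⟨w'.1, hw'⟩ ((archVec F n x i).1 v.1)]
    have e1 := congrArg (fun y : mixedSpace F => y.2 v)
      ((InfiniteAdeleRing.ringEquiv_mixedSpace F).apply_symm_apply (x i))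
    exact congrArg _ e1
  have hδw : ∀ w' : {w : InfinitePlace E // w.IsComplex}, adeleAt E w' (algebraMap E (AdeleRing (𝓞 E) E) δ) = w'.1.embedding δ := by
    intro w'
    rw [adeleAt_apply, AdeleRing.algebraMap_fst_apply]
    exact Completion.extensionEmbedding_coe w'.1 (WithAbs.toAbs w'.1.1 δ)
  simp only [adeleAtCC_apply, splitPairCoords_apply, quadraticAdeleEquiv_apply]
  refine Prod.ext ?_ ?_
  · show adeleAt E w _ = _
    rw [map_add, map_mul, hδw, adeleAt_apply, adeleAt_apply, hbc w hover, hbc w hover]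
  · show conjCoord F E c (cPlaceC F E c w) (adeleAt E (cPlaceC F E c w) _) = _
    rw [map_add, map_mul, hδw, adeleAt_apply, adeleAt_apply, hbc (cPlaceC F E c w) ((comap_cPlaceC F E c w).trans hover),
      hbc (cPlaceC F E c w) ((comap_cPlaceC F E c w).trans hover), map_add, map_mul,
      conjCoord_placeTwist_cPlaceC F E c hcc v w hover, conjCoord_placeTwist_cPlaceC F E c hcc v w hover,
      conjCoord_embedding_cPlaceC_delta F E c hcc w hcδ, mul_neg, sub_eq_add_neg]

omit [Fintype n] [DecidableEq n] in
include hcc hover in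
/-- **the twisted `v`-coordinates of `Ψ_𝔸⁻¹ Y` are `splitPairCoords⁻¹ (adeleAtCC w Y)`.** [cite: CasselsFrohlichANT1967, Ch. II §14] -/
theorem placeTwist_quadraticAdeleEquiv_symm (Y : AdeleRing (𝓞 E) E) :
    (placeTwist F E v ⟨w.1, hover⟩ (Completion.extensionEmbedding v.1 (((quadraticAdeleEquiv F E c hcδ hδ).symm Y).1.1 v.1)),
      placeTwist F E v ⟨w.1, hover⟩ (Completion.extensionEmbedding v.1 (((quadraticAdeleEquiv F E c hcδ hδ).symm Y).2.1 v.1))) =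
      (splitPairCoords (w.1.embedding δ) (embedding_ne_zero E w hδ)).symm (adeleAtCC F E c w Y) := by
  have hδF : δ ∉ Set.range (algebraMap F E) := not_mem_range_algebraMap_of_apply_eq_neg E c hcδ hδ
  rw [AddEquiv.eq_symm_apply]
  set p : v.1.Completion × v.1.Completion := (quadraticInfLocalEquiv E v.1 hδF).symm fun w' => Y.1 w'.1 with hp_def
  have hp : ((((quadraticAdeleEquiv F E c hcδ hδ).symm Y).1.1 v.1),
      (((quadraticAdeleEquiv F E c hcδ hδ).symm Y).2.1 v.1)) = p := by
    rw [hp_def, ← quadraticInfiniteAdeleEquiv_symm_apply_local E hδF Y.1 v.1]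
    exact congrArg (fun q : InfiniteAdeleRing F × InfiniteAdeleRing F => (q.1 v.1, q.2 v.1))
      (quadraticAdeleEquiv_symm_fst E c hcδ hδ Y)
  have h1 : (((quadraticAdeleEquiv F E c hcδ hδ).symm Y).1.1 v.1) = p.1 := congrArg Prod.fst hp
  have h2 : (((quadraticAdeleEquiv F E c hcδ hδ).symm Y).2.1 v.1) = p.2 := congrArg Prod.snd hp
  rw [h1, h2, placeTwist_extensionEmbedding, placeTwist_extensionEmbedding]
  -- `Y_{w'} = (Ψ_v p)_{w'} = ι_{w'} p.1 + ι_{w'} p.2 δ` at both places over `v`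
  have hY : ∀ w' : InfPlacesOver E v.1, Y.1 w'.1 = toInfPlace E v.1 w' p.1 + toInfPlace E v.1 w' p.2 * ((δ : E) : w'.1.Completion) := by
    intro w'
    have h3 : (quadraticInfLocalEquiv E v.1 hδF p) w' = Y.1 w'.1 := by
      rw [hp_def, ContinuousLinearEquiv.apply_symm_apply]
    rw [← h3]
    exact quadraticInfLocalMap_apply_apply E v.1 δ p w'
  have hδe : ∀ w' : {w : InfinitePlace E // w.IsComplex},
      Completion.extensionEmbedding w'.1 ((δ : E) : w'.1.Completion) = w'.1.embedding δ := fun w' =>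
    Completion.extensionEmbedding_coe w'.1 (WithAbs.toAbs w'.1.1 δ)
  simp only [adeleAtCC_apply, splitPairCoords_apply, adeleAt_apply]
  refine Prod.ext ?_ ?_
  · show _ = Completion.extensionEmbedding w.1 (Y.1 w.1)
    rw [hY ⟨w.1, hover⟩, map_add, map_mul, hδe w]
  · show _ = conjCoord F E c (cPlaceC F E c w) (Completion.extensionEmbedding (cPlaceC F E c w).1 (Y.1 (cPlaceC F E c w).1))
    rw [hY ⟨(cPlaceC F E c w).1, (comap_cPlaceC F E c w).trans hover⟩, map_add, map_mul, hδe (cPlaceC F E c w),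
      map_add, map_mul,
      ← placeTwist_extensionEmbedding F E v ⟨(cPlaceC F E c w).1, (comap_cPlaceC F E c w).trans hover⟩ p.1,
      ← placeTwist_extensionEmbedding F E v ⟨(cPlaceC F E c w).1, (comap_cPlaceC F E c w).trans hover⟩ p.2,
      conjCoord_placeTwist_cPlaceC F E c hcc v w hover, conjCoord_placeTwist_cPlaceC F E c hcc v w hover,
      conjCoord_embedding_cPlaceC_delta F E c hcc w hcδ, placeTwist_extensionEmbedding, placeTwist_extensionEmbedding,
      mul_neg, sub_eq_add_neg]

include hcc hover in
/-- **CORE — restriction of scalars `E/F` on `𝔸_E`-matrices read at the pair `(w, cw)` over a COMPLEX place `v`.**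
For `G ∈ Mₙ(𝔸_E)` the `v`-slices of the archimedean coordinates of `Res_{𝔸_E/𝔸_F} G` on an archimedean pair
`(a, b)`, read through the coordinate twist `ψ = placeTwist v w`, are the split-pair restriction of scalars of
`G.map (adeleAtCC w)` on the twisted slices: `ψ (piArch (Res G (a, b)))_v = Res_{ℂ×ℂ/ℂ} (G_{w,cw}) (ψ a_v, ψ b_v)`.
[cite: CasselsFrohlichANT1967, Ch. II §14; GelbartRogawski1991, §3.1 p. 454] -/
theorem placeVecC_piArch_resEnd (G : Matrix n n (AdeleRing (𝓞 E) E)) (a b : n → mixedSpace F) :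
    ((fun j => placeTwist F E v ⟨w.1, hover⟩ (placeVecC F n v (piArch F n ((isQuadraticCoordinates_adele E c hcδ hδ hd).resEnd n G
        (archVec F n a, archVec F n b)).1) j)),
      (fun j => placeTwist F E v ⟨w.1, hover⟩ (placeVecC F n v (piArch F n ((isQuadraticCoordinates_adele E c hcδ hδ hd).resEnd n G
        (archVec F n a, archVec F n b)).2) j))) =
      (isQuadraticCoordinates_splitPair (w.1.embedding δ) (embedding_ne_zero E w hδ)).resEnd n (G.map (adeleAtCC F E c w))
        ((fun j => placeTwist F E v ⟨w.1, hover⟩ (placeVecC F n v a j)),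
          (fun j => placeTwist F E v ⟨w.1, hover⟩ (placeVecC F n v b j))) := by
  set Ψ : (AdeleRing (𝓞 F) F × AdeleRing (𝓞 F) F) ≃+ AdeleRing (𝓞 E) E :=
    (quadraticAdeleEquiv F E c hcδ hδ).toAddEquiv with hΨ
  set cc : (ℂ × ℂ) ≃+ (ℂ × ℂ) := splitPairCoords (w.1.embedding δ) (embedding_ne_zero E w hδ) with hcc'
  set ψ := placeTwist F E v ⟨w.1, hover⟩ with hψ
  set z : n → AdeleRing (𝓞 E) E := fun i => Ψ (archVec F n a i, archVec F n b i) with hz_def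
  set zc : n → ℂ × ℂ := fun i => cc (ψ (placeVecC F n v a i), ψ (placeVecC F n v b i)) with hzc_def
  have h1 : (isQuadraticCoordinates_adele E c hcδ hδ hd).resEnd n G (archVec F n a, archVec F n b) =
      reIm Ψ n (G *ᵥ z) := by
    rw [← (isQuadraticCoordinates_adele E c hcδ hδ hd).resEnd_reIm]
    exact congrArg _ ((reIm Ψ n).apply_symm_apply _).symm
  have h2 : (isQuadraticCoordinates_splitPair (w.1.embedding δ) (embedding_ne_zero E w hδ)).resEnd n
      (G.map (adeleAtCC F E c w)) ((fun j => ψ (placeVecC F n v a j)), (fun j => ψ (placeVecC F n v b j))) =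
      reIm cc n (G.map (adeleAtCC F E c w) *ᵥ zc) := by
    rw [← (isQuadraticCoordinates_splitPair (w.1.embedding δ) (embedding_ne_zero E w hδ)).resEnd_reIm]
    exact congrArg _ ((reIm cc n).apply_symm_apply _).symm
  have hz : ∀ i, adeleAtCC F E c w (z i) = zc i := fun i =>
    adeleAtCC_quadraticAdeleEquiv_archVec F E c hcc n v w hover hcδ hδ a b i
  have hGz : ∀ j, adeleAtCC F E c w ((G *ᵥ z) j) = (G.map (adeleAtCC F E c w) *ᵥ zc) j := by
    intro j
    rw [RingHom.map_mulVec]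
    congr 1
    funext i
    exact hz i
  have hloc := fun Y => placeTwist_quadraticAdeleEquiv_symm F E c hcc v w hover hcδ hδ Y
  rw [h1, h2]
  refine Prod.ext (funext fun j => ?_) (funext fun j => ?_)
  · change ψ (Completion.extensionEmbedding v.1 (((quadraticAdeleEquiv F E c hcδ hδ).symm ((G *ᵥ z) j)).1.1 v.1))
      = (cc.symm ((G.map (adeleAtCC F E c w) *ᵥ zc) j)).1
    rw [← hGz j, ← hloc]
  · change ψ (Completion.extensionEmbedding v.1 (((quadraticAdeleEquiv F E c hcδ hδ).symm ((G *ᵥ z) j)).2.1 v.1))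
      = (cc.symm ((G.map (adeleAtCC F E c w) *ᵥ zc) j)).2
    rw [← hGz j, ← hloc]

end Core

/-! ## §3 Through the unitary carrier maps -/

section Unitary

variable (F : Type) [Field F] [NumberField F] (E : Type) [Field E] [NumberField E] [Algebra F E]
  [Algebra.IsQuadraticExtension F E] (c : E ≃ₐ[F] E) (hcc : c * c = 1) (N : ℕ)
  {δ : E} (hcδ : c δ = -δ) (hδ : δ ≠ 0) {d : F} (hd : δ * δ = algebraMap F E d)
  {T : Matrix (Fin N) (Fin N) F} (hT : T.IsSymm) {J : Matrix (Fin N) (Fin N) E} (hJ : J = T.map (algebraMap F E))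
  (v : {v : InfinitePlace F // v.IsComplex}) (w : {w : InfinitePlace E // w.IsComplex})
  (hover : w.1.comap (algebraMap F E) = v.1)

include hcc in
/-- **(α) `ι_𝔸` at a complex place of `F`.** For `u ∈ U(J)(𝔸_F)` (`J = T ⊗ 1`) the twisted `v`-slices of
`archAct (ι_𝔸 u)` are the split-pair restriction of scalars of `u_{w,cw} = u.map (adeleAtCC w)`.
[cite: GelbartRogawski1991, §3.1 p. 454] -/
theorem placeVecC_archAct_adelicToSymplectic (u : adelic F E c N J) (a b : Fin N → mixedSpace F) :
    ((fun j => placeTwist F E v ⟨w.1, hover⟩ (placeVecC F (Fin N) v (archAct (T.map (algebraMap F (AdeleRing (𝓞 F) F)))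
        (adelicToSymplectic F E c N hcδ hδ hd hT hJ u) (a, b)).1 j)),
      (fun j => placeTwist F E v ⟨w.1, hover⟩ (placeVecC F (Fin N) v (archAct (T.map (algebraMap F (AdeleRing (𝓞 F) F)))
        (adelicToSymplectic F E c N hcδ hδ hd hT hJ u) (a, b)).2 j))) =
      (isQuadraticCoordinates_splitPair (w.1.embedding δ) (embedding_ne_zero E w hδ)).resEnd (Fin N)
        (((u : GL (Fin N) (AdeleRing (𝓞 E) E)) : Matrix (Fin N) (Fin N) (AdeleRing (𝓞 E) E)).map (adeleAtCC F E c w))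
        ((fun j => placeTwist F E v ⟨w.1, hover⟩ (placeVecC F (Fin N) v a j)),
          (fun j => placeTwist F E v ⟨w.1, hover⟩ (placeVecC F (Fin N) v b j))) :=
  placeVecC_piArch_resEnd F E c hcc (Fin N) v w hover hcδ hδ hd
    ((u : GL (Fin N) (AdeleRing (𝓞 E) E)) : Matrix (Fin N) (Fin N) (AdeleRing (𝓞 E) E)) a b

include hcc in
/-- **(β) `ι_𝔸 (g, 1)` at a complex place of `F` IS `toSymplectic` of the `(w, cw)`-factor.**  For
`g ∈ U(J)(F ⊗ ℝ)` the twisted `v`-slices of `archAct (ι_𝔸 (g, 1))` are the tree's symplectic embedding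
`toSymplectic : U(swap, σ_w(T) ⊗ 1)(ℂ × ℂ) → Sp((ℂᴺ)², polar β_{σ_w(T)})` (quadratic coordinates `1, (s, -s)`,
`s = σ_w δ`, over `R = ℂ`) of `archAtComplexSplit w g`, applied to the twisted slices `(ψ a_v, ψ b_v)`.
[cite: GelbartRogawski1991, §3.1 p. 454; MoeglinVignerasWaldspurger1987, Chap. 1 I.17] -/
theorem placeVecC_archAct_archToAdelic (g : arch F E c N J) (a b : Fin N → mixedSpace F) :
    ((fun j => placeTwist F E v ⟨w.1, hover⟩ (placeVecC F (Fin N) v (archAct (T.map (algebraMap F (AdeleRing (𝓞 F) F)))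
        (adelicToSymplectic F E c N hcδ hδ hd hT hJ (archToAdelic F E c N J g)) (a, b)).1 j)),
      (fun j => placeTwist F E v ⟨w.1, hover⟩ (placeVecC F (Fin N) v (archAct (T.map (algebraMap F (AdeleRing (𝓞 F) F)))
        (adelicToSymplectic F E c N hcδ hδ hd hT hJ (archToAdelic F E c N J g)) (a, b)).2 j))) =
      ((isQuadraticCoordinates_splitPair (w.1.embedding δ) (embedding_ne_zero E w hδ)).toSymplectic (Fin N)
          (hT.map (cxEmbOfPlace F E w)) (swap_pair_diag (K := ℂ)) (swap_pair_delta (w.1.embedding δ)) rfl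
          (archAtComplexSplit F E c N hcc w T hJ g)).1
        ((fun j => placeTwist F E v ⟨w.1, hover⟩ (placeVecC F (Fin N) v a j)),
          (fun j => placeTwist F E v ⟨w.1, hover⟩ (placeVecC F (Fin N) v b j))) := by
  rw [placeVecC_archAct_adelicToSymplectic F E c hcc N hcδ hδ hd hT hJ v w hover, map_adeleAtCC_coe_archToAdelic,
    IsQuadraticCoordinates.coe_toSymplectic, IsQuadraticCoordinates.resAut_apply, coe_archAtComplexSplit]
  rfl

end Unitary

end Literature.NumberTheory.Weil1964

end
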